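import Literature.Analysis.FluidPDE.CylindricalGenerator
import HarnessLib

/-!
# Stub `stub_penalisationLimit` (S4) of the line `dissipation-deficit-duality`
# (crux stmt-AnomalousDissipation-14091, `TaylorCertificates.FloorCertificate`)

THE PENALISATION LIMIT. Fix `ν > 0` and a smooth force `f` on `T³`; write `H` for the energy
space, `ρ = 16‖f‖²/ν²` for the squared Leray radius, `ε(μ) = ν ∫‖∇u‖² dμ` for the mean
dissipation, `⟨F(u), Φ'(u)⟩` for the Navier–Stokes generator tested against a cylindrical
functional and `(u, f)` for the work. Suppose that for every `n : ℕ` an `(n, M)`-APPROXIMATELY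
RELAXED statistic `μₙ` is given: a Borel probability measure on `H` carried by the ball
`{|u|² ≤ ρ}`, of finite mean enstrophy, with `ε(μₙ) ≤ M` and penalised Lagrangian
`ε(μₙ) + ∫⟨F,Φ'⟩dμₙ + 2θ(∫(u,f)dμₙ − ε(μₙ)) ≤ M` against every multiplier `(Φ, θ)` with
`−n ≤ θ ≤ 0` and `|⟨F,Φ'⟩| ≤ n` on the ball. Then, GIVEN the sister stubs S0 (lower
semicontinuity of the mean enstrophy on `ProbabilityMeasure H`), S1 (compactness of the
dissipation sublevel sets of ball-carried probability measures) and S3a (linear combinations of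
cylindrical test functionals realised on a ball), an EXACT relaxed stationary statistic with
`ε ≤ M` exists: a probability measure `μ` carried by the ball, of finite mean enstrophy,
annihilating every cylindrical Liouville functional, with integrable work and the global energy
inequality `ε(μ) ≤ ∫(u,f)dμ`.

## Proof

`M ≥ 0` (test `n = 0`: `0 ≤ ε(μ₀) ≤ M`). Every `μₙ` lies in the compact set
`S = {μ : μ-a.e. |u|² ≤ ρ, ∫⁻‖∇u‖² ≤ M/ν}` of S1, so the sequence has a CLUSTER POINT `μ ∈ S`; all
limits are taken along the filter `𝓕 = 𝓝 μ ⊓ map μ. atTop` (nontrivial, convergent to `μ`, finer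
than the tails of the sequence; `ProbabilityMeasure.tendsto_iff_forall_integral_tendsto` holds
along any filter, so no metrisability is needed). Continuous observables bounded on the ball (the
tested generator, `Torus.continuous_nsGeneratorPairing_grad`,
`Torus.exists_abs_nsGeneratorPairing_grad_le`; the work, `Torus.continuous_pairing_coe`,
`Torus.abs_pairing_coe_le`) are clipped to bounded continuous functions agreeing with them on the
ball. Liouville: `±kΦ` is realised on the ball by S3a with slope `≤ k C_Φ ≤ n` for large `n`, so
testing `μₙ` with `(±kΦ, 0)` gives `|∫⟨F,Φ'⟩dμₙ| ≤ M/k`; pass to the limit, let `k → ∞`. Energy: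
the flat functional (no coordinates, `⟨F, 0⟩ = 0`) with `θ = −n` gives
`ε(μₙ) − ∫(u,f)dμₙ ≤ M/(2n)`; the work converges along `𝓕` and the mean enstrophy is lower
semicontinuous (S0, made real-valued by `ENNReal.truncateToReal` at level `M/ν`).

References: Foias–Manley–Rosa–Temam, *Navier–Stokes Equations and Turbulence* (2001), Ch. IV
§1.2 (stationary statistical solutions; the vocabulary of `StatisticalSolution.lean`); the line
skeleton `Cruxes/FloorCertificate/Lines/dissipation-deficit-duality.lean` (lead's reshape 1).
-/

noncomputable section

set_option linter.dupNamespace false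

namespace Summit.AnomalousDissipation.AnomalousDissipation.Theorems.TaylorCertificatesFloorCertificate

open MeasureTheory Filter Topology UnitAddTorus
open scoped InnerProductSpace ENNReal NNReal BoundedContinuousFunction
open Literature.Analysis.FunctionSpaces Literature.Analysis.FluidPDE

namespace PenalisationLimit

/-! ## Bounded continuous modifications of observables bounded on a ball -/

/-- A continuous real function bounded by `B` in absolute value on a set `s` agrees on `s` with a
bounded continuous function (clip the values to `[-B, B]`). [folklore] -/
theorem exists_boundedContinuous_eqOn {X : Type*} [TopologicalSpace X] {h : X → ℝ}
    (hc : Continuous h) {s : Set X} {B : ℝ} (hB : ∀ x ∈ s, |h x| ≤ B) :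
    ∃ hb : X →ᵇ ℝ, ∀ x ∈ s, hb x = h x := by
  refine ⟨BoundedContinuousFunction.ofNormedAddCommGroup (fun x => max (-B) (min B (h x)))
    (continuous_const.max (continuous_const.min hc)) |B| fun x => ?_, fun x hx => ?_⟩
  · rw [Real.norm_eq_abs, abs_le]
    exact ⟨(neg_le_neg (le_abs_self B)).trans (le_max_left _ _),
      max_le (neg_le_abs B) ((min_le_left _ _).trans (le_abs_self B))⟩
  · obtain ⟨h1, h2⟩ := abs_le.1 (hB x hx)
    show max (-B) (min B (h x)) = h x
    rw [min_eq_right h2, max_eq_right h1]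

/-- A continuous observable on `H` bounded on the ball `{|u|² ≤ ρ}` has a bounded continuous
modification computing its integral against every finite measure carried by the ball. [folklore] -/
theorem exists_boundedContinuous_integral_eq {h : Torus.energySpace (Fin 3) → ℝ}
    (hc : Continuous h) {ρ B : ℝ} (hB : ∀ u : Torus.energySpace (Fin 3), ‖u‖ ^ 2 ≤ ρ → |h u| ≤ B) :
    ∃ hb : Torus.energySpace (Fin 3) →ᵇ ℝ,
      ∀ (μ : Measure (Torus.energySpace (Fin 3))) [IsFiniteMeasure μ],
        (∀ᵐ u ∂μ, ‖u‖ ^ 2 ≤ ρ) → Integrable h μ ∧ ∫ u, h u ∂μ = ∫ u, hb u ∂μ := by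
  obtain ⟨hb, hhb⟩ := exists_boundedContinuous_eqOn hc
    (s := {u : Torus.energySpace (Fin 3) | ‖u‖ ^ 2 ≤ ρ}) fun u hu => hB u hu
  refine ⟨hb, fun μ _ hball => ?_⟩
  have hae : (fun u => hb u) =ᵐ[μ] h := hball.mono fun u hu => hhb u hu
  exact ⟨(hb.integrable μ).congr hae, integral_congr_ae hae.symm⟩

/-! ## The tested generator: scaling and the flat test -/

/-- `Φ'(u)` is a smooth field (finite combination of the smooth `gᵢ`). [folklore] -/
theorem isSmooth_grad (Φ : Torus.CylindricalTest (Fin 3)) (u : Torus.energySpace (Fin 3)) :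
    Torus.IsSmooth (Φ.grad u) :=
  Torus.isSmooth_sum_smul Finset.univ
    (fun i => _root_.fderiv ℝ Φ.φ (Φ.coords u) (EuclideanSpace.single i 1)) (g := Φ.g)
    fun i _ => Φ.g_smooth i

/-- Homogeneity of the tested generator in the test field: `⟨F(u), a g⟩ = a ⟨F(u), g⟩` for a
smooth field `g` and an integrable force. [folklore] -/
theorem nsGeneratorPairing_const_smul (ν : ℝ) {f g : UnitAddTorus (Fin 3) → EuclideanSpace ℝ (Fin 3)}
    (hf : Integrable f volume) (hg : Torus.IsSmooth g) (u : Torus.energySpace (Fin 3)) (a : ℝ) :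
    Torus.nsGeneratorPairing ν f u (a • g) = a * Torus.nsGeneratorPairing ν f u g := by
  have h := Torus.nsGeneratorPairing_sum_smul ν hf u (Finset.univ : Finset (Fin 1)) (fun _ => a)
    (g := fun _ => g) (fun _ _ => hg)
  simp only [Finset.univ_unique, Fin.default_eq_zero, Finset.sum_singleton] at h
  exact h

/-- The FLAT cylindrical test functional (no coordinates) has vanishing tested generator
`⟨F(u), Φ₀'(u)⟩ = 0` at every state (an empty sum). [folklore] -/
theorem exists_cylindricalTest_generator_zero (ν : ℝ)
    {f : UnitAddTorus (Fin 3) → EuclideanSpace ℝ (Fin 3)} (hf : Integrable f volume) :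
    ∃ Φ₀ : Torus.CylindricalTest (Fin 3),
      ∀ u : Torus.energySpace (Fin 3), Torus.nsGeneratorPairing ν f u (Φ₀.grad u) = 0 := by
  refine ⟨{ m := 0
            g := fun i => i.elim0
            g_smooth := fun i => i.elim0
            g_divFree := fun i => i.elim0
            g_zeroMean := fun i => i.elim0
            φ := fun _ => 0
            φ_contDiff := contDiff_const
            φ_compact := HasCompactSupport.zero }, fun u => ?_⟩
  rw [Torus.nsGeneratorPairing_grad ν hf]
  simp

/-! ## Testing an approximately relaxed statistic -/

/-- SCALED LIOUVILLE TEST. If `μ` is carried by the ball `{|u|² ≤ ρ}`, has `ε(μ) ≥ 0` and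
penalised Lagrangian `≤ M` against every multiplier of slope `≤ L`, then for a cylindrical `Φ`
with `|⟨F,Φ'⟩| ≤ C` on the ball and a real `a` with `|a| C ≤ L`: `a ∫⟨F,Φ'⟩dμ ≤ M` (test with
the functional `aΦ` realised on the ball by S3a, and `θ = 0`). -/
theorem scaled_generator_le {ν : ℝ} {f : UnitAddTorus (Fin 3) → EuclideanSpace ℝ (Fin 3)}
    (hf : Torus.IsSmooth f)
    (hS3a : ∀ (ρ a b : ℝ) (Φ₁ Φ₂ : Torus.CylindricalTest (Fin 3)),
      ∃ Φ₀ : Torus.CylindricalTest (Fin 3), ∀ u : Torus.energySpace (Fin 3),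
        ‖u‖ ^ 2 ≤ ρ → Φ₀.grad u = a • Φ₁.grad u + b • Φ₂.grad u)
    {ρ L M C a : ℝ} {μ : Measure (Torus.energySpace (Fin 3))} (hball : ∀ᵐ u ∂μ, ‖u‖ ^ 2 ≤ ρ)
    (hD : 0 ≤ Torus.ensembleDissipation ν μ)
    (hmult : ∀ (Φ : Torus.CylindricalTest (Fin 3)) (θ : ℝ), -L ≤ θ → θ ≤ 0 →
      (∀ u : Torus.energySpace (Fin 3), ‖u‖ ^ 2 ≤ ρ →
        |Torus.nsGeneratorPairing ν f u (Φ.grad u)| ≤ L) →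
      Torus.ensembleDissipation ν μ + ∫ u, Torus.nsGeneratorPairing ν f u (Φ.grad u) ∂μ +
        2 * θ * ((∫ u, Torus.pairing u.1 f ∂μ) - Torus.ensembleDissipation ν μ) ≤ M)
    (hL : 0 ≤ L) (Φ : Torus.CylindricalTest (Fin 3))
    (hC : ∀ u : Torus.energySpace (Fin 3), ‖u‖ ^ 2 ≤ ρ →
      |Torus.nsGeneratorPairing ν f u (Φ.grad u)| ≤ C)
    (ha : |a| * C ≤ L) :
    a * ∫ u, Torus.nsGeneratorPairing ν f u (Φ.grad u) ∂μ ≤ M := by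
  obtain ⟨Φa, hΦa⟩ := hS3a ρ a 0 Φ Φ
  have heq : ∀ u : Torus.energySpace (Fin 3), ‖u‖ ^ 2 ≤ ρ → Torus.nsGeneratorPairing ν f u (Φa.grad u) =
      a * Torus.nsGeneratorPairing ν f u (Φ.grad u) := by
    intro u hu
    rw [hΦa u hu, zero_smul, add_zero]
    exact nsGeneratorPairing_const_smul ν hf.integrable (isSmooth_grad Φ u) u a
  have hslope : ∀ u : Torus.energySpace (Fin 3), ‖u‖ ^ 2 ≤ ρ →
      |Torus.nsGeneratorPairing ν f u (Φa.grad u)| ≤ L := by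
    intro u hu
    rw [heq u hu, abs_mul]
    exact (mul_le_mul_of_nonneg_left (hC u hu) (abs_nonneg a)).trans ha
  have h := hmult Φa 0 (neg_nonpos.2 hL) le_rfl hslope
  have hint : ∫ u, Torus.nsGeneratorPairing ν f u (Φa.grad u) ∂μ =
      a * ∫ u, Torus.nsGeneratorPairing ν f u (Φ.grad u) ∂μ := by
    rw [← integral_const_mul]
    exact integral_congr_ae (hball.mono fun u hu => heq u hu)
  rw [hint] at h
  simp only [mul_zero, zero_mul, add_zero] at h
  linarith

/-- FLAT ENERGY TEST. If `μ` has penalised Lagrangian `≤ M` against every multiplier of slope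
`≤ L`, then `2L (ε(μ) − ∫(u,f)dμ) ≤ M − ε(μ)` (test with the flat functional and `θ = −L`). -/
theorem energy_defect_le {ν : ℝ} {f : UnitAddTorus (Fin 3) → EuclideanSpace ℝ (Fin 3)}
    (hf : Torus.IsSmooth f) {ρ L M : ℝ} {μ : Measure (Torus.energySpace (Fin 3))}
    (hmult : ∀ (Φ : Torus.CylindricalTest (Fin 3)) (θ : ℝ), -L ≤ θ → θ ≤ 0 →
      (∀ u : Torus.energySpace (Fin 3), ‖u‖ ^ 2 ≤ ρ →
        |Torus.nsGeneratorPairing ν f u (Φ.grad u)| ≤ L) →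
      Torus.ensembleDissipation ν μ + ∫ u, Torus.nsGeneratorPairing ν f u (Φ.grad u) ∂μ +
        2 * θ * ((∫ u, Torus.pairing u.1 f ∂μ) - Torus.ensembleDissipation ν μ) ≤ M)
    (hL : 0 ≤ L) :
    2 * L * (Torus.ensembleDissipation ν μ - ∫ u, Torus.pairing u.1 f ∂μ) ≤
      M - Torus.ensembleDissipation ν μ := by
  obtain ⟨Φ0, hΦ0⟩ := exists_cylindricalTest_generator_zero ν hf.integrable
  have h := hmult Φ0 (-L) le_rfl (neg_nonpos.2 hL) fun u _ => by rw [hΦ0 u, abs_zero]; exact hL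
  have hint : ∫ u, Torus.nsGeneratorPairing ν f u (Φ0.grad u) ∂μ = 0 := by
    simp only [hΦ0, integral_zero]
  rw [hint] at h
  linarith

/-! ## Limit bookkeeping along a filter -/

/-- If `J → j` along a nontrivial filter and eventually `|J| ≤ M/k` for every `k > 0`, then
`j = 0`. [folklore] -/
theorem eq_zero_of_tendsto_of_abs_le {X : Type*} {𝓕 : Filter X} [𝓕.NeBot] {J : X → ℝ}
    {j M : ℝ} (hJ : Tendsto J 𝓕 (𝓝 j)) (hb : ∀ k : ℝ, 0 < k → ∀ᶠ x in 𝓕, |J x| ≤ M / k) :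
    j = 0 := by
  have hk : ∀ k : ℝ, 0 < k → |j| ≤ M / k := fun k hk => le_of_tendsto hJ.abs (hb k hk)
  have hlim : Tendsto (fun k : ℝ => M / k) atTop (𝓝 0) := tendsto_const_nhds.div_atTop tendsto_id
  exact abs_nonpos_iff.1 (ge_of_tendsto hlim ((eventually_gt_atTop 0).mono fun k hk' => hk k hk'))

/-- Lower semicontinuity of `A` at `x₀` along a nontrivial filter, convergence of `W` to `W x₀`,
and an eventually small defect `ν A − W ≤ ε` for every `ε > 0` give `ν A x₀ ≤ W x₀`.
[folklore] -/
theorem mul_le_of_lsc_of_tendsto {X : Type*} {𝓕 : Filter X} [𝓕.NeBot] {A W : X → ℝ}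
    {x₀ : X} {ν : ℝ} (hν : 0 < ν) (hA : ∀ y < A x₀, ∀ᶠ x in 𝓕, y < A x)
    (hW : Tendsto W 𝓕 (𝓝 (W x₀))) (hdef : ∀ ε : ℝ, 0 < ε → ∀ᶠ x in 𝓕, ν * A x - W x ≤ ε) :
    ν * A x₀ ≤ W x₀ := by
  refine le_of_forall_pos_le_add fun ε hε => ?_
  have hδ : 0 < ε / (3 * ν) := by positivity
  have e1 := hA (A x₀ - ε / (3 * ν)) (sub_lt_self _ hδ)
  have e2 := hdef (ε / 3) (by positivity)
  have e3 : ∀ᶠ x in 𝓕, W x < W x₀ + ε / 3 := hW.eventually (eventually_lt_nhds (by linarith))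
  obtain ⟨x, h1, h2, h3⟩ := (e1.and (e2.and e3)).exists
  have h1' := mul_lt_mul_of_pos_left h1 hν
  have hν0 : ν ≠ 0 := hν.ne'
  have hνε : ν * (A x₀ - ε / (3 * ν)) = ν * A x₀ - ε / 3 := by field_simp
  rw [hνε] at h1'
  linarith

end PenalisationLimit

open PenalisationLimit

/-! ## The stub -/

/-- **S4 `stub_penalisationLimit`** — THE PENALISATION LIMIT, GIVEN S0, S1, S3a. For `ν > 0` and
smooth `f`: if for every `n : ℕ` there is an `(n, M)`-approximately relaxed statistic `μₙ`, then
an EXACT relaxed stationary statistic of mean dissipation `≤ M` exists. -/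
theorem stub_penalisationLimit :
    (LowerSemicontinuous fun μ : ProbabilityMeasure (Torus.energySpace (Fin 3)) =>
      Torus.ensembleEnstrophy (μ : Measure (Torus.energySpace (Fin 3)))) →
    (∀ (ρ : ℝ) (c : ℝ≥0∞), c ≠ ⊤ →
      IsCompact {μ : ProbabilityMeasure (Torus.energySpace (Fin 3)) |
        (∀ᵐ u ∂(μ : Measure (Torus.energySpace (Fin 3))), ‖u‖ ^ 2 ≤ ρ) ∧
          Torus.ensembleEnstrophy (μ : Measure (Torus.energySpace (Fin 3))) ≤ c}) →
    (∀ (ρ a b : ℝ) (Φ₁ Φ₂ : Torus.CylindricalTest (Fin 3)), ∃ Φ₀ : Torus.CylindricalTest (Fin 3),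
      ∀ u : Torus.energySpace (Fin 3), ‖u‖ ^ 2 ≤ ρ → Φ₀.grad u = a • Φ₁.grad u + b • Φ₂.grad u) →
    ∀ (ν : ℝ) (f : UnitAddTorus (Fin 3) → EuclideanSpace ℝ (Fin 3)), 0 < ν → Torus.IsSmooth f →
    ∀ (M : ℝ) (μs : ℕ → Measure (Torus.energySpace (Fin 3))),
      (∀ n : ℕ,
        IsProbabilityMeasure (μs n) ∧
        (∀ᵐ u ∂(μs n), ‖u‖ ^ 2 ≤ 16 * (∫ x, ‖f x‖ ^ 2) / ν ^ 2) ∧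
        Torus.ensembleEnstrophy (μs n) < ⊤ ∧
        Integrable (fun u : Torus.energySpace (Fin 3) => Torus.pairing u.1 f) (μs n) ∧
        (∀ Φ : Torus.CylindricalTest (Fin 3),
          Integrable (fun u => Torus.nsGeneratorPairing ν f u (Φ.grad u)) (μs n)) ∧
        Torus.ensembleDissipation ν (μs n) ≤ M ∧
        ∀ (Φ : Torus.CylindricalTest (Fin 3)) (θ : ℝ), -(n : ℝ) ≤ θ → θ ≤ 0 →
          (∀ u : Torus.energySpace (Fin 3), ‖u‖ ^ 2 ≤ 16 * (∫ x, ‖f x‖ ^ 2) / ν ^ 2 →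
            |Torus.nsGeneratorPairing ν f u (Φ.grad u)| ≤ (n : ℝ)) →
          Torus.ensembleDissipation ν (μs n) + ∫ u, Torus.nsGeneratorPairing ν f u (Φ.grad u) ∂(μs n) +
              2 * θ * ((∫ u, Torus.pairing u.1 f ∂(μs n)) - Torus.ensembleDissipation ν (μs n)) ≤ M) →
      ∃ μ : Measure (Torus.energySpace (Fin 3)),
        (IsProbabilityMeasure μ ∧
          (∀ᵐ u ∂μ, ‖u‖ ^ 2 ≤ 16 * (∫ x, ‖f x‖ ^ 2) / ν ^ 2) ∧
          Torus.ensembleEnstrophy μ < ⊤ ∧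
          (∀ Φ : Torus.CylindricalTest (Fin 3),
            Integrable (fun u => Torus.nsGeneratorPairing ν f u (Φ.grad u)) μ ∧
              ∫ u, Torus.nsGeneratorPairing ν f u (Φ.grad u) ∂μ = 0) ∧
          Integrable (fun u : Torus.energySpace (Fin 3) => Torus.pairing u.1 f) μ ∧
          Torus.ensembleDissipation ν μ ≤ ∫ u, Torus.pairing u.1 f ∂μ) ∧
        Torus.ensembleDissipation ν μ ≤ M := by
  intro hlsc hcpt hS3a ν f hν hf M μs h
  -- `ε ≥ 0`, hence `M ≥ 0`
  have hDnonneg : ∀ μ' : Measure (Torus.energySpace (Fin 3)), 0 ≤ Torus.ensembleDissipation ν μ' :=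
    fun μ' => mul_nonneg hν.le ENNReal.toReal_nonneg
  have hM : 0 ≤ M := (hDnonneg (μs 0)).trans (h 0).2.2.2.2.2.1
  set ρ : ℝ := 16 * (∫ x, ‖f x‖ ^ 2) / ν ^ 2
  -- the enstrophy level `c = M/ν`
  set c : ℝ≥0∞ := ENNReal.ofReal (M / ν)
  have hcν : 0 ≤ M / ν := div_nonneg hM hν.le
  have hEn : ∀ n, Torus.ensembleEnstrophy (μs n) ≤ c := fun n => by
    obtain ⟨-, -, hfin, -, -, hDle, -⟩ := h n
    refine (ENNReal.le_ofReal_iff_toReal_le hfin.ne hcν).2 ?_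
    rw [le_div_iff₀' hν]
    exact hDle
  -- lift the sequence to `ProbabilityMeasure H`
  obtain ⟨P, hP⟩ : ∃ P : ℕ → ProbabilityMeasure (Torus.energySpace (Fin 3)),
      ∀ n, (P n : Measure (Torus.energySpace (Fin 3))) = μs n :=
    ⟨fun n => ⟨μs n, (h n).1⟩, fun n => rfl⟩
  -- the compact sublevel set of S1 containing the sequence
  set S : Set (ProbabilityMeasure (Torus.energySpace (Fin 3))) :=
    {μ | (∀ᵐ u ∂(μ : Measure (Torus.energySpace (Fin 3))), ‖u‖ ^ 2 ≤ ρ) ∧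
      Torus.ensembleEnstrophy (μ : Measure (Torus.energySpace (Fin 3))) ≤ c}
  have hS : IsCompact S := hcpt ρ c ENNReal.ofReal_ne_top
  have hPS : ∀ n, P n ∈ S := fun n =>
    ⟨by rw [hP n]; exact (h n).2.1, by rw [hP n]; exact hEn n⟩
  -- a cluster point `μ ∈ S` and the cluster filter `𝓕`
  obtain ⟨μ, hμS, hcl⟩ := hS.exists_clusterPt (f := map P atTop)
    (le_principal_iff.2 (mem_map.2 (univ_mem' hPS)))
  set 𝓕 : Filter (ProbabilityMeasure (Torus.energySpace (Fin 3))) := 𝓝 μ ⊓ map P atTop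
  haveI h𝓕ne : 𝓕.NeBot := hcl.neBot
  have hT : ∀ g : Torus.energySpace (Fin 3) →ᵇ ℝ,
      Tendsto (fun μ' : ProbabilityMeasure (Torus.energySpace (Fin 3)) =>
        ∫ u, g u ∂(μ' : Measure (Torus.energySpace (Fin 3)))) 𝓕
        (𝓝 (∫ u, g u ∂(μ : Measure (Torus.energySpace (Fin 3))))) := fun g =>
    ProbabilityMeasure.tendsto_iff_forall_integral_tendsto.1 (tendsto_id'.2 inf_le_left) g
  have hev : ∀ {p : ProbabilityMeasure (Torus.energySpace (Fin 3)) → Prop} (N : ℕ),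
      (∀ n, N ≤ n → p (P n)) → ∀ᶠ μ' in 𝓕, p μ' := by
    intro p N hp
    have h2 : ∀ᶠ μ' in map P atTop, p μ' := eventually_map.2 (eventually_atTop.2 ⟨N, hp⟩)
    exact h2.filter_mono inf_le_right
  -- the limit: probability, carried by the ball, enstrophy `≤ M/ν`
  have hμball : ∀ᵐ u ∂(μ : Measure (Torus.energySpace (Fin 3))), ‖u‖ ^ 2 ≤ ρ := hμS.1
  have hμE : Torus.ensembleEnstrophy (μ : Measure (Torus.energySpace (Fin 3))) ≤ c := hμS.2
  have hμfin : Torus.ensembleEnstrophy (μ : Measure (Torus.energySpace (Fin 3))) < ⊤ :=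
    hμE.trans_lt ENNReal.ofReal_lt_top
  have hμD : Torus.ensembleDissipation ν (μ : Measure (Torus.energySpace (Fin 3))) ≤ M :=
    (le_div_iff₀' hν).1 (ENNReal.toReal_le_of_le_ofReal hcν hμE)
  -- (ii) the Liouville identity
  have hLiou : ∀ Φ : Torus.CylindricalTest (Fin 3),
      Integrable (fun u => Torus.nsGeneratorPairing ν f u (Φ.grad u))
          (μ : Measure (Torus.energySpace (Fin 3))) ∧
        ∫ u, Torus.nsGeneratorPairing ν f u (Φ.grad u) ∂(μ : Measure (Torus.energySpace (Fin 3))) =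
          0 := by
    intro Φ
    obtain ⟨K, hK0, hK⟩ := Torus.exists_abs_nsGeneratorPairing_grad_le ν (hf.memLp 2) Φ
    have hC : ∀ u : Torus.energySpace (Fin 3), ‖u‖ ^ 2 ≤ ρ →
        |Torus.nsGeneratorPairing ν f u (Φ.grad u)| ≤ K * (1 + ρ) :=
      fun u hu => (hK u).trans (mul_le_mul_of_nonneg_left (by linarith) hK0)
    obtain ⟨gb, hgb⟩ := exists_boundedContinuous_integral_eq
      (Torus.continuous_nsGeneratorPairing_grad ν hf.integrable Φ) hC
    have hIn : ∀ n, Integrable (fun u => Torus.nsGeneratorPairing ν f u (Φ.grad u)) (μs n) ∧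
        ∫ u, Torus.nsGeneratorPairing ν f u (Φ.grad u) ∂(μs n) = ∫ u, gb u ∂(μs n) := fun n => by
      haveI := (h n).1
      exact hgb (μs n) (h n).2.1
    have hIμ := hgb (μ : Measure (Torus.energySpace (Fin 3))) hμball
    refine ⟨hIμ.1, ?_⟩
    rw [hIμ.2]
    have hb : ∀ k : ℝ, 0 < k → ∀ᶠ μ' : ProbabilityMeasure (Torus.energySpace (Fin 3)) in 𝓕,
        |∫ u, gb u ∂(μ' : Measure (Torus.energySpace (Fin 3)))| ≤ M / k := by
      intro k hk
      obtain ⟨N, hN⟩ := exists_nat_ge (k * (K * (1 + ρ)))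
      refine hev N fun n hn => ?_
      rw [hP n, ← (hIn n).2]
      have hkn : |k| * (K * (1 + ρ)) ≤ (n : ℝ) := by
        rw [abs_of_pos hk]
        exact hN.trans (by exact_mod_cast hn)
      have h1 := scaled_generator_le hf hS3a (h n).2.1 (hDnonneg _) (h n).2.2.2.2.2.2
        (Nat.cast_nonneg n) Φ hC hkn
      have h2 := scaled_generator_le hf hS3a (h n).2.1 (hDnonneg _) (h n).2.2.2.2.2.2
        (Nat.cast_nonneg n) Φ hC (show |(-k)| * (K * (1 + ρ)) ≤ (n : ℝ) by rwa [abs_neg])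
      rw [abs_le, neg_le, le_div_iff₀ hk, le_div_iff₀ hk]
      constructor <;> linarith
    exact eq_zero_of_tendsto_of_abs_le (hT gb) hb
  -- (iii)/(iv) the work functional and the energy inequality
  have hwc : Continuous fun u : Torus.energySpace (Fin 3) => Torus.pairing u.1 f :=
    Torus.continuous_pairing_coe (hf.memLp 2)
  have hwB : ∀ u : Torus.energySpace (Fin 3), ‖u‖ ^ 2 ≤ ρ →
      |Torus.pairing u.1 f| ≤ (1 + ρ) * ‖(hf.memLp 2).toLp f‖ := by
    intro u hu
    refine (Torus.abs_pairing_coe_le (hf.memLp 2) u).trans ?_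
    refine mul_le_mul_of_nonneg_right ?_ (norm_nonneg _)
    nlinarith [sq_nonneg (‖u‖ - 1), norm_nonneg u, hu]
  obtain ⟨wb, hwb⟩ := exists_boundedContinuous_integral_eq hwc hwB
  have hWn : ∀ n, Integrable (fun u : Torus.energySpace (Fin 3) => Torus.pairing u.1 f) (μs n) ∧
      ∫ u, Torus.pairing u.1 f ∂(μs n) = ∫ u, wb u ∂(μs n) := fun n => by
    haveI := (h n).1
    exact hwb (μs n) (h n).2.1
  have hWμ := hwb (μ : Measure (Torus.energySpace (Fin 3))) hμball
  -- lower semicontinuity of the (truncated, real) mean enstrophy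
  have hElsc : LowerSemicontinuous fun μ' : ProbabilityMeasure (Torus.energySpace (Fin 3)) =>
      ENNReal.truncateToReal c
        (Torus.ensembleEnstrophy (μ' : Measure (Torus.energySpace (Fin 3)))) :=
    (ENNReal.continuous_truncateToReal ENNReal.ofReal_ne_top).comp_lowerSemicontinuous hlsc
      (ENNReal.monotone_truncateToReal ENNReal.ofReal_ne_top)
  -- the defect `ε(μₙ) − ∫(u,f)dμₙ ≤ M/(2n)` is eventually small along `𝓕`
  have hdef : ∀ ε : ℝ, 0 < ε → ∀ᶠ μ' : ProbabilityMeasure (Torus.energySpace (Fin 3)) in 𝓕,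
      ν * ENNReal.truncateToReal c
          (Torus.ensembleEnstrophy (μ' : Measure (Torus.energySpace (Fin 3)))) -
        ∫ u, wb u ∂(μ' : Measure (Torus.energySpace (Fin 3))) ≤ ε := by
    intro ε hε
    obtain ⟨N, hN⟩ := exists_nat_ge (M / (2 * ε))
    have hN' : M ≤ (N : ℝ) * (2 * ε) := (div_le_iff₀ (by positivity)).1 hN
    refine hev (N + 1) fun n hn => ?_
    rw [ENNReal.truncateToReal_eq_toReal ENNReal.ofReal_ne_top (hPS n).2, hP n, ← (hWn n).2]
    have hd := energy_defect_le hf (h n).2.2.2.2.2.2 (Nat.cast_nonneg n)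
    have hD0 := hDnonneg (μs n)
    have hNn : (N : ℝ) * (2 * ε) ≤ (n : ℝ) * (2 * ε) :=
      mul_le_mul_of_nonneg_right (by exact_mod_cast (Nat.le_succ N).trans hn) (by positivity)
    have hn1 : (1 : ℝ) ≤ n := by exact_mod_cast (Nat.le_add_left 1 N).trans hn
    unfold Torus.ensembleDissipation at hd hD0
    refine not_lt.1 fun hcon => ?_
    have hprod := mul_lt_mul_of_pos_left hcon (by linarith : (0 : ℝ) < 2 * (n : ℝ))
    linarith
  have hmain : ν * ENNReal.truncateToReal c
      (Torus.ensembleEnstrophy (μ : Measure (Torus.energySpace (Fin 3)))) ≤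
        ∫ u, wb u ∂(μ : Measure (Torus.energySpace (Fin 3))) :=
    mul_le_of_lsc_of_tendsto (x₀ := μ) hν
      (A := fun μ' : ProbabilityMeasure (Torus.energySpace (Fin 3)) =>
        ENNReal.truncateToReal c
          (Torus.ensembleEnstrophy (μ' : Measure (Torus.energySpace (Fin 3)))))
      (W := fun μ' : ProbabilityMeasure (Torus.energySpace (Fin 3)) =>
        ∫ u, wb u ∂(μ' : Measure (Torus.energySpace (Fin 3))))
      (fun y hy => ((hElsc μ) y hy).filter_mono inf_le_left) (hT wb) hdef
  rw [ENNReal.truncateToReal_eq_toReal ENNReal.ofReal_ne_top hμE, ← hWμ.2] at hmain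
  exact ⟨(μ : Measure (Torus.energySpace (Fin 3))),
    ⟨inferInstance, hμball, hμfin, hLiou, hWμ.1, hmain⟩, hμD⟩

end Summit.AnomalousDissipation.AnomalousDissipation.Theorems.TaylorCertificatesFloorCertificate

end
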